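import Literature.MathematicalPhysics.QuantumManyBody.GaussianCharges
import HarnessLib

/-!
# Onsager's electrostatic lemma with Gaussian smearing

Topic `Literature/MathematicalPhysics/QuantumManyBody` (electrostatics groundwork for the charged
Bose gas, `JelliumBoseGas.foldyLaw`; continuation of `GaussianCharges.lean`). Onsager's lemma
[Onsager1939; LiebSeiringer2009, Lemma 6.1 (6.4.1)–(6.4.3)] trades the correlated Coulomb
repulsion `∑_{i<j} |xᵢ - xⱼ|⁻¹` of `N` point charges for one-body quantities: for every background
density `ρ` and every family of unit charge clouds `μᵢ` centred at the (distinct) points `xᵢ`,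

`∑_{i<j} e²/|xᵢ - xⱼ| ≥ -D(ρ, ρ) + 2 ∑ᵢ D(ρ, μᵢ) - ∑ᵢ D(μᵢ, μᵢ)`  (Lieb–Seiringer's `D = ½∬·/|x-y|`),

by positive definiteness of the Coulomb kernel applied to `ρ - ∑ᵢ μᵢ` [LiebLoss2001, Thm. 9.8;
LiebSeiringer2009, Thm. 5.1] and `D(μᵢ, μⱼ) ≤ ½|xᵢ - xⱼ|⁻¹`. The printed proof takes spherically
symmetric compactly supported clouds and Newton's theorem for the last step; here the clouds are
heat kernels `μᵢ = G_t(· - xᵢ)` on `ℝ³`, for which everything is explicit by subordination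
(`GaussianCharges.lean`): `D(μᵢ, μⱼ) = ∫_{2t}^∞ G_u(xᵢ - xⱼ) du ≤ (4π|xᵢ - xⱼ|)⁻¹`, the self-energy
is `∫_{2t}^∞ G_u(0) du = 1/(4π√(2πt))`, and the potential of a cloud is
`V_t(z) = ∫_t^∞ G_u(z) du ≤ (4π|z|)⁻¹` with Coulomb defect `(4π|z|)⁻¹ - V_t(z) = ∫₀^t G_u(z) du` of
total mass `∫_{ℝ³} ((4π|z|)⁻¹ - V_t(z)) dz = t`. We use the tree's normalisation
`D(f, g) = ∬ f(x) g(y) (4π|x - y|)⁻¹` of `CoulombEnergyPositivity.lean` throughout.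

* `Coulomb.integrableOn_Ioi_heatKernel_of_pos`, `cloudPotential_nonneg/le_self/le_coulomb`,
  `coulomb_sub_cloudPotential`, `measurable_cloudPotential` — the cloud potential
  `V_t(z) = ∫_t^∞ G_u(z) du ∈ [0, min((4π|z|)⁻¹, (4π√(πt))⁻¹)]`.
* `Coulomb.lintegral_cloudDefect`, `integral_cloudDefect` — **`∫ (∫₀^t G_u(z) du) dz = t`**.
* `Coulomb.integral_heatKernel_mul_coulomb` — `∫ G_t(x - b)(4π|x - y|)⁻¹ dx = V_t(y - b)`;
  `Coulomb.integral_prod_gaussian_gaussian_coulomb` — `D(G_s(· - a), G_t(· - b)) = ∫_{s+t}^∞ G_u(a-b)du`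
  with integrability; `Coulomb.integral_prod_gaussian_mul_coulomb` —
  `D(G_t(· - b), ρ) = ∫ ρ(y) V_t(y - b) dy` with integrability, for `ρ ∈ L¹`.
* `Coulomb.sum_sum_eq_diag_add_two_mul` — `∑ᵢ∑ⱼ aᵢⱼ = ∑ᵢ aᵢᵢ + 2∑_{i<j} aᵢⱼ` for symmetric `a`.
* `Coulomb.onsager_clouds_nonneg` — **`0 ≤ D(∑ᵢ μᵢ - ρ, ∑ᵢ μᵢ - ρ)` expanded**:
  `0 ≤ ∑ᵢ∑ⱼ ∫_{2t}^∞ G_u(xᵢ - xⱼ)du - 2∑ᵢ ∫ ρ(y)V_t(xᵢ - y)dy + D(ρ, ρ)` (no distinctness needed).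
* `Coulomb.onsager_lemma` — **Onsager's lemma** [LiebSeiringer2009, Lemma 6.1] with Gaussian
  clouds: for distinct `x₁, …, x_N`, `t > 0` and a real density `ρ ∈ L¹(ℝ³)` of finite absolute
  Coulomb energy,
  `∑ᵢ ∫ ρ(y) V_t(xᵢ - y) dy - ½ D(ρ, ρ) - N/(8π√(2πt)) ≤ ∑_{i<j} (4π|xᵢ - xⱼ|)⁻¹`.

The jellium consequence (`U ≥ -(3/2) N ρ^{1/3}` for a bounded background, Lieb–Narnhofer) is in
`JelliumOnsagerBound.lean`.

## References

* [LiebSeiringer2009] E. H. Lieb, R. Seiringer, *The Stability of Matter in Quantum Mechanics*,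
  Cambridge Univ. Press (2010), §5.1 (5.1.3)–(5.1.5), Thm. 5.1; §6.4, Lemma 6.1 (Onsager's lemma),
  (6.4.1)–(6.4.4) (pp. 97–98 of the held copy).
* [Onsager1939] L. Onsager, *Electrostatic interaction of molecules*, J. Phys. Chem. 43 (1939)
  189–196.
* [LiebLoss2001] E. H. Lieb, M. Loss, *Analysis*, 2nd ed. (2001), Thm. 9.8.
* [LiebNarnhofer1975] E. H. Lieb, H. Narnhofer, J. Stat. Phys. 12 (1975) 291–310.
-/

noncomputable section

open MeasureTheory Set Filter Real
open scoped ENNReal NNReal Topology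
open Literature.Analysis.UnboundedOperators

namespace Literature.MathematicalPhysics.QuantumManyBody.Coulomb

open BoseGas

/-! ### The potential of a Gaussian cloud, `V_t(z) = ∫_t^∞ G_u(z) du` -/

/-- `u ↦ G_u(z)` is measurable. [folklore] -/
theorem measurable_heatKernel_left (z : Space) : Measurable fun u : ℝ => heatKernel u z :=
  measurable_heatKernel_uncurry.comp (measurable_id.prodMk measurable_const)

/-- `u ↦ G_u(z)` is integrable on `(t, ∞)` for `t > 0` and every `z` (domination by `G_u(0)`).
[folklore] -/
theorem integrableOn_Ioi_heatKernel_of_pos {t : ℝ} (ht : 0 < t) (z : Space) :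
    IntegrableOn (fun u : ℝ => heatKernel u z) (Ioi t) := by
  have h0 := (integral_Ioi_heatKernel_zero ht).1
  refine h0.mono' (measurable_heatKernel_left z).aestronglyMeasurable ?_
  refine (ae_restrict_iff' measurableSet_Ioi).2 (Eventually.of_forall fun u hu => ?_)
  have hu0 : 0 < u := ht.trans hu
  rw [Real.norm_of_nonneg (heatKernel_pos hu0 _).le]
  exact heatKernel_le_heatKernel_zero hu0 z

/-- The cloud potential is nonnegative: `0 ≤ V_t(z)`. [folklore] -/
theorem cloudPotential_nonneg {t : ℝ} (ht : 0 ≤ t) (z : Space) :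
    0 ≤ ∫ u in Ioi t, heatKernel u z :=
  setIntegral_nonneg measurableSet_Ioi fun _ hu => (heatKernel_pos (ht.trans_lt hu) z).le

/-- The cloud potential is bounded by the self-energy scale: `V_t(z) ≤ (4π√(πt))⁻¹`. [folklore] -/
theorem cloudPotential_le_self {t : ℝ} (ht : 0 < t) (z : Space) :
    ∫ u in Ioi t, heatKernel u z ≤ (4 * π * Real.sqrt (π * t))⁻¹ := by
  rw [← (integral_Ioi_heatKernel_zero ht).2]
  exact setIntegral_mono_on (integrableOn_Ioi_heatKernel_of_pos ht z)
    (integral_Ioi_heatKernel_zero ht).1 measurableSet_Ioi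
    fun _ hu => heatKernel_le_heatKernel_zero (ht.trans hu) z

/-- The cloud potential is bounded by the point-charge potential: `V_t(z) ≤ (4π|z|)⁻¹`, `z ≠ 0`
(Newton's theorem is an inequality for Gaussian clouds). [folklore] -/
theorem cloudPotential_le_coulomb {t : ℝ} (ht : 0 ≤ t) {z : Space} (hz : z ≠ 0) :
    ∫ u in Ioi t, heatKernel u z ≤ (4 * π * ‖z‖)⁻¹ := by
  rw [← integral_Ioi_heatKernel hz]
  exact setIntegral_mono_set (integrableOn_Ioi_heatKernel hz)
    ((ae_restrict_iff' measurableSet_Ioi).2 (Eventually.of_forall fun u hu =>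
      (heatKernel_pos (show (0 : ℝ) < u from hu) z).le))
    (Ioi_subset_Ioi ht).eventuallyLE

/-- **The Coulomb defect of a cloud**: `(4π|z|)⁻¹ - V_t(z) = ∫₀^t G_u(z) du` for `z ≠ 0`.
[folklore] -/
theorem coulomb_sub_cloudPotential {t : ℝ} (ht : 0 < t) {z : Space} (hz : z ≠ 0) :
    (4 * π * ‖z‖)⁻¹ - ∫ u in Ioi t, heatKernel u z = ∫ u in Ioc 0 t, heatKernel u z := by
  rw [← integral_Ioi_heatKernel hz, ← Ioc_union_Ioi_eq_Ioi ht.le,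
    setIntegral_union (Ioc_disjoint_Ioi le_rfl) measurableSet_Ioi
      ((integrableOn_Ioi_heatKernel hz).mono_set Ioc_subset_Ioi_self)
      ((integrableOn_Ioi_heatKernel hz).mono_set (Ioi_subset_Ioi ht.le))]
  ring

/-- The cloud potential `z ↦ V_t(z)` is measurable. [folklore] -/
theorem measurable_cloudPotential (t : ℝ) :
    Measurable fun z : Space => ∫ u in Ioi t, heatKernel u z := by
  have h : StronglyMeasurable fun q : Space × ℝ => heatKernel q.2 q.1 :=
    (measurable_heatKernel_uncurry.comp (measurable_snd.prodMk measurable_fst)).stronglyMeasurable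
  exact (h.integral_prod_right' (ν := volume.restrict (Ioi t))).measurable

/-- The Coulomb defect `z ↦ ∫₀^t G_u(z) du` is measurable. [folklore] -/
theorem measurable_cloudDefect (t : ℝ) :
    Measurable fun z : Space => ∫ u in Ioc 0 t, heatKernel u z := by
  have h : StronglyMeasurable fun q : Space × ℝ => heatKernel q.2 q.1 :=
    (measurable_heatKernel_uncurry.comp (measurable_snd.prodMk measurable_fst)).stronglyMeasurable
  exact (h.integral_prod_right' (ν := volume.restrict (Ioc 0 t))).measurable

/-- **Total mass of the Coulomb defect**: `∫_{ℝ³} (∫₀^t G_u(z) du) dz = t` (`ℝ≥0∞` form, both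
sides `0` for `t ≤ 0`; Tonelli and `∫ G_u = 1`). [folklore] -/
theorem lintegral_cloudDefect (t : ℝ) :
    ∫⁻ z : Space, ENNReal.ofReal (∫ u in Ioc 0 t, heatKernel u z) = ENNReal.ofReal t := by
  have hae : ∀ᵐ z : Space ∂volume, z ≠ 0 := by
    have : (volume : Measure Space) {z | ¬z ≠ 0} = 0 := by
      simp only [ne_eq, not_not, setOf_eq_eq_singleton, measure_singleton]
    exact ae_iff.2 this
  have step1 : ∫⁻ z : Space, ENNReal.ofReal (∫ u in Ioc 0 t, heatKernel u z) =
      ∫⁻ z : Space, ∫⁻ u in Ioc 0 t, ENNReal.ofReal (heatKernel u z) := by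
    refine lintegral_congr_ae ?_
    filter_upwards [hae] with z hz
    exact ofReal_integral_eq_lintegral_ofReal
      ((integrableOn_Ioi_heatKernel hz).mono_set Ioc_subset_Ioi_self)
      ((ae_restrict_iff' measurableSet_Ioc).2 (Eventually.of_forall fun u hu =>
        (heatKernel_pos hu.1 z).le))
  have hmeas : Measurable fun q : Space × ℝ => ENNReal.ofReal (heatKernel q.2 q.1) :=
    ENNReal.measurable_ofReal.comp
      (measurable_heatKernel_uncurry.comp (measurable_snd.prodMk measurable_fst))
  rw [step1, lintegral_lintegral_swap hmeas.aemeasurable]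
  have step2 : ∀ u ∈ Ioc (0 : ℝ) t, ∫⁻ z : Space, ENNReal.ofReal (heatKernel u z) = 1 := by
    intro u hu
    rw [← ofReal_integral_eq_lintegral_ofReal (integrable_heatKernel_holds (E := Space) hu.1)
      (Eventually.of_forall fun z => (heatKernel_pos hu.1 z).le),
      integral_heatKernel_eq_one_holds (E := Space) hu.1, ENNReal.ofReal_one]
  rw [setLIntegral_congr_fun measurableSet_Ioc step2, setLIntegral_const, Real.volume_Ioc, one_mul,
    sub_zero]

/-- The Coulomb defect `z ↦ ∫₀^t G_u(z) du` is integrable on `ℝ³`. [folklore] -/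
theorem integrable_cloudDefect (t : ℝ) :
    Integrable fun z : Space => ∫ u in Ioc 0 t, heatKernel u z := by
  refine ⟨(measurable_cloudDefect t).aestronglyMeasurable, (hasFiniteIntegral_iff_ofReal ?_).2 ?_⟩
  · exact Eventually.of_forall fun z =>
      setIntegral_nonneg measurableSet_Ioc fun u hu => (heatKernel_pos hu.1 z).le
  · rw [lintegral_cloudDefect t]
    exact ENNReal.ofReal_lt_top

/-- **`∫_{ℝ³} (∫₀^t G_u(z) du) dz = t`**: the Coulomb defect of a Gaussian cloud has total mass `t`.
[folklore] -/
theorem integral_cloudDefect {t : ℝ} (ht : 0 < t) :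
    ∫ z : Space, ∫ u in Ioc 0 t, heatKernel u z = t := by
  rw [integral_eq_lintegral_of_nonneg_ae (Eventually.of_forall fun z =>
      setIntegral_nonneg measurableSet_Ioc fun u hu => (heatKernel_pos hu.1 z).le)
    (measurable_cloudDefect t).aestronglyMeasurable, lintegral_cloudDefect t,
    ENNReal.toReal_ofReal ht.le]

/-! ### Coulomb energies of clouds, real-valued forms -/

/-- **Potential of a cloud**, real form: `∫ G_t(x - b) (4π|x - y|)⁻¹ dx = V_t(y - b)`. [folklore] -/
theorem integral_heatKernel_mul_coulomb {t : ℝ} (ht : 0 < t) (y b : Space) :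
    ∫ x : Space, heatKernel t (x - b) * (4 * π * ‖x - y‖)⁻¹ = ∫ u in Ioi t, heatKernel u (y - b) := by
  have hnn : ∀ x : Space, 0 ≤ heatKernel t (x - b) * (4 * π * ‖x - y‖)⁻¹ := fun x =>
    mul_nonneg (heatKernel_pos ht _).le (inv_nonneg.2 (by positivity))
  have hm : AEStronglyMeasurable (fun x : Space => heatKernel t (x - b) * (4 * π * ‖x - y‖)⁻¹)
      volume :=
    (((continuous_heatKernel t).measurable.comp (measurable_id.sub measurable_const)).mul
      ((measurable_const.mul (measurable_id.sub measurable_const).norm).inv)).aestronglyMeasurable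
  rw [integral_eq_lintegral_of_nonneg_ae (Eventually.of_forall hnn) hm]
  have h1 : ∫⁻ x : Space, ENNReal.ofReal (heatKernel t (x - b) * (4 * π * ‖x - y‖)⁻¹) =
      ∫⁻ u in Ioi t, ENNReal.ofReal (heatKernel u (y - b)) := by
    have h2 : ∀ x : Space, ENNReal.ofReal (heatKernel t (x - b) * (4 * π * ‖x - y‖)⁻¹) =
        ENNReal.ofReal (heatKernel t (x - b)) * ENNReal.ofReal ((4 * π * ‖y - x‖)⁻¹) := by
      intro x
      rw [ENNReal.ofReal_mul (heatKernel_pos ht _).le, norm_sub_rev]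
    simp_rw [h2]
    rw [lintegral_heatKernel_mul_coulomb ht y b]
    exact lintegral_Ioi_comp_add_right (fun u => ENNReal.ofReal (heatKernel u (y - b))) t
  rw [h1, ← ofReal_integral_eq_lintegral_ofReal (integrableOn_Ioi_heatKernel_of_pos ht _)
    ((ae_restrict_iff' measurableSet_Ioi).2 (Eventually.of_forall fun u hu =>
      (heatKernel_pos (ht.trans hu) _).le)), ENNReal.toReal_ofReal (cloudPotential_nonneg ht.le _)]

/-- **Interaction of two clouds**, real form on the product space: for `0 < s, t`,
`(x, y) ↦ G_s(x - a) G_t(y - b) (4π|x - y|)⁻¹` is integrable on `ℝ³ × ℝ³` and its integral is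
`∫_{s+t}^∞ G_u(a - b) du`. [folklore] -/
theorem integral_prod_gaussian_gaussian_coulomb {s t : ℝ} (hs : 0 < s) (ht : 0 < t) (a b : Space) :
    Integrable (fun z : Space × Space =>
        heatKernel s (z.1 - a) * heatKernel t (z.2 - b) * (4 * π * ‖z.1 - z.2‖)⁻¹)
        (volume.prod volume) ∧
      ∫ z : Space × Space, heatKernel s (z.1 - a) * heatKernel t (z.2 - b) * (4 * π * ‖z.1 - z.2‖)⁻¹
          ∂(volume.prod volume) = ∫ u in Ioi (s + t), heatKernel u (a - b) := by
  set F : Space × Space → ℝ := fun z =>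
    heatKernel s (z.1 - a) * heatKernel t (z.2 - b) * (4 * π * ‖z.1 - z.2‖)⁻¹ with hF
  have hnn : ∀ z, 0 ≤ F z := fun z =>
    mul_nonneg (mul_nonneg (heatKernel_pos hs _).le (heatKernel_pos ht _).le)
      (inv_nonneg.2 (by positivity))
  have hFm : Measurable F :=
    ((((continuous_heatKernel s).measurable.comp (measurable_fst.sub measurable_const)).mul
      ((continuous_heatKernel t).measurable.comp (measurable_snd.sub measurable_const))).mul
      ((measurable_const.mul (measurable_fst.sub measurable_snd).norm).inv))
  have hlin : ∫⁻ z, ENNReal.ofReal (F z) ∂(volume.prod volume) =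
      ∫⁻ u in Ioi (s + t), ENNReal.ofReal (heatKernel u (a - b)) := by
    rw [lintegral_prod (fun z : Space × Space => ENNReal.ofReal (F z))
      (ENNReal.measurable_ofReal.comp hFm).aemeasurable]
    have h2 : ∀ x y : Space, ENNReal.ofReal (F (x, y)) = ENNReal.ofReal (heatKernel s (x - a)) *
        (ENNReal.ofReal (heatKernel t (y - b)) * ENNReal.ofReal ((4 * π * ‖x - y‖)⁻¹)) := by
      intro x y
      simp only [hF]
      rw [ENNReal.ofReal_mul (mul_nonneg (heatKernel_pos hs _).le (heatKernel_pos ht _).le),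
        ENNReal.ofReal_mul (heatKernel_pos hs _).le, mul_assoc]
    simp_rw [h2]
    exact lintegral_gaussian_gaussian_coulomb hs ht a b
  have hst : 0 < s + t := add_pos hs ht
  have hval : ∫⁻ u in Ioi (s + t), ENNReal.ofReal (heatKernel u (a - b)) =
      ENNReal.ofReal (∫ u in Ioi (s + t), heatKernel u (a - b)) :=
    (ofReal_integral_eq_lintegral_ofReal (integrableOn_Ioi_heatKernel_of_pos hst _)
      ((ae_restrict_iff' measurableSet_Ioi).2 (Eventually.of_forall fun u hu =>
        (heatKernel_pos (hst.trans hu) _).le))).symm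
  refine ⟨⟨hFm.aestronglyMeasurable, (hasFiniteIntegral_iff_ofReal (Eventually.of_forall hnn)).2 ?_⟩,
    ?_⟩
  · rw [hlin, hval]
    exact ENNReal.ofReal_lt_top
  · rw [integral_eq_lintegral_of_nonneg_ae (Eventually.of_forall hnn) hFm.aestronglyMeasurable,
      hlin, hval, ENNReal.toReal_ofReal (cloudPotential_nonneg hst.le _)]

/-- **Interaction of a cloud with a background density**, real form: for `t > 0` and a real
measurable `ρ ∈ L¹(ℝ³)`, `(x, y) ↦ G_t(x - b) ρ(y) (4π|x - y|)⁻¹` is integrable on `ℝ³ × ℝ³`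
(the cloud potential is bounded by `(4π√(πt))⁻¹`) and its integral is `∫ ρ(y) V_t(y - b) dy`.
[folklore] -/
theorem integral_prod_gaussian_mul_coulomb {t : ℝ} (ht : 0 < t) (b : Space) {ρ : Space → ℝ}
    (hρm : Measurable ρ) (hρ : Integrable ρ) :
    Integrable (fun z : Space × Space =>
        heatKernel t (z.1 - b) * ρ z.2 * (4 * π * ‖z.1 - z.2‖)⁻¹) (volume.prod volume) ∧
      ∫ z : Space × Space, heatKernel t (z.1 - b) * ρ z.2 * (4 * π * ‖z.1 - z.2‖)⁻¹
          ∂(volume.prod volume) = ∫ y, ρ y * ∫ u in Ioi t, heatKernel u (y - b) := by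
  set F : Space × Space → ℝ := fun z =>
    heatKernel t (z.1 - b) * ρ z.2 * (4 * π * ‖z.1 - z.2‖)⁻¹ with hF
  have hFm : Measurable F :=
    ((((continuous_heatKernel t).measurable.comp (measurable_fst.sub measurable_const)).mul
      (hρm.comp measurable_snd)).mul
      ((measurable_const.mul (measurable_fst.sub measurable_snd).norm).inv))
  have hfin : HasFiniteIntegral F (volume.prod volume) := by
    show ∫⁻ z, ‖F z‖ₑ ∂(volume.prod volume) < ⊤
    rw [lintegral_prod_symm (fun z : Space × Space => ‖F z‖ₑ) hFm.enorm.aemeasurable]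
    have h3 : ∀ x y : Space, ‖F (x, y)‖ₑ = ‖ρ y‖ₑ *
        (ENNReal.ofReal (heatKernel t (x - b)) * ENNReal.ofReal ((4 * π * ‖y - x‖)⁻¹)) := by
      intro x y
      simp only [hF]
      rw [enorm_mul, enorm_mul, Real.enorm_eq_ofReal (heatKernel_pos ht _).le,
        Real.enorm_eq_ofReal (inv_nonneg.2 (by positivity)), norm_sub_rev]
      ring
    simp_rw [h3]
    have h4 : ∀ y : Space, ∫⁻ x : Space, ‖ρ y‖ₑ *
        (ENNReal.ofReal (heatKernel t (x - b)) * ENNReal.ofReal ((4 * π * ‖y - x‖)⁻¹)) ≤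
        ‖ρ y‖ₑ * ENNReal.ofReal ((4 * π * Real.sqrt (π * t))⁻¹) := by
      intro y
      rw [lintegral_const_mul' _ _ enorm_ne_top, lintegral_heatKernel_mul_coulomb ht y b,
        lintegral_Ioi_comp_add_right (fun u => ENNReal.ofReal (heatKernel u (y - b))) t]
      exact mul_le_mul' le_rfl (lintegral_Ioi_heatKernel_le_self ht _)
    calc ∫⁻ y : Space, ∫⁻ x : Space, ‖ρ y‖ₑ *
          (ENNReal.ofReal (heatKernel t (x - b)) * ENNReal.ofReal ((4 * π * ‖y - x‖)⁻¹))
        ≤ ∫⁻ y : Space, ‖ρ y‖ₑ * ENNReal.ofReal ((4 * π * Real.sqrt (π * t))⁻¹) :=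
          lintegral_mono h4
      _ = (∫⁻ y : Space, ‖ρ y‖ₑ) * ENNReal.ofReal ((4 * π * Real.sqrt (π * t))⁻¹) :=
          lintegral_mul_const _ hρm.enorm
      _ < ⊤ := ENNReal.mul_lt_top hρ.2 ENNReal.ofReal_lt_top
  have hint : Integrable F (volume.prod volume) := ⟨hFm.aestronglyMeasurable, hfin⟩
  refine ⟨hint, ?_⟩
  rw [integral_prod_symm F hint]
  refine integral_congr_ae (Eventually.of_forall fun y => ?_)
  have h5 : (fun x : Space => F (x, y)) =
      fun x => ρ y * (heatKernel t (x - b) * (4 * π * ‖x - y‖)⁻¹) := by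
    funext x
    simp only [hF]
    ring
  simp only
  rw [h5, integral_const_mul, integral_heatKernel_mul_coulomb ht y b]

/-! ### Onsager's lemma -/

/-- Splitting a symmetric double sum into its diagonal and twice its upper triangle:
`∑ᵢ ∑ⱼ aᵢⱼ = ∑ᵢ aᵢᵢ + 2 ∑_{i<j} aᵢⱼ`. [folklore] -/
theorem sum_sum_eq_diag_add_two_mul {N : ℕ} (a : Fin N → Fin N → ℝ)
    (hsymm : ∀ i j, a i j = a j i) :
    ∑ i, ∑ j, a i j = ∑ i, a i i + 2 * ∑ i, ∑ j with i < j, a i j := by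
  have h1 : ∀ i : Fin N, ∑ j, a i j = a i i + ((∑ j with i < j, a i j) + ∑ j with j < i, a i j) := by
    intro i
    rw [← Finset.sum_filter_add_sum_filter_not Finset.univ (fun j => i < j)]
    have hset : (Finset.univ.filter fun j : Fin N => ¬i < j) =
        insert i (Finset.univ.filter fun j => j < i) := by
      ext j
      simp only [Finset.mem_filter, Finset.mem_univ, true_and, Finset.mem_insert, not_lt]
      constructor
      · intro h
        rcases h.lt_or_eq with h | h
        · exact Or.inr h
        · exact Or.inl h
      · rintro (rfl | h)
        · exact le_rfl
        · exact h.le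
    rw [hset, Finset.sum_insert (by simp)]
    ring
  have h2 : ∑ i, ∑ j with j < i, a i j = ∑ i, ∑ j with i < j, a i j := by
    rw [Finset.sum_comm' (t' := Finset.univ) (s' := fun j => Finset.univ.filter fun i => j < i)
      (fun i j => by simp)]
    exact Finset.sum_congr rfl fun j _ => Finset.sum_congr rfl fun i _ => hsymm _ _
  rw [Finset.sum_congr rfl fun i _ => h1 i, Finset.sum_add_distrib, Finset.sum_add_distrib, h2]
  ring

/-- **Positive definiteness applied to `∑ᵢ G_t(· - xᵢ) - ρ`** [LiebSeiringer2009, (6.4.2)–(6.4.3)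
with Gaussian clouds]: for points `x₁, …, x_N ∈ ℝ³` (not necessarily distinct), `t > 0` and a
real measurable `ρ ∈ L¹(ℝ³)` of finite absolute Coulomb energy,
`0 ≤ ∑ᵢ ∑ⱼ ∫_{2t}^∞ G_u(xᵢ - xⱼ) du - 2 ∑ᵢ ∫ ρ(y) V_t(xᵢ - y) dy + ∬ ρ(x)ρ(y)(4π|x - y|)⁻¹`,
`V_t(z) = ∫_t^∞ G_u(z) du`: this is `0 ≤ D(f, f)` (`coulombEnergy_nonneg`) for
`f = ∑ᵢ G_t(· - xᵢ) - ρ`, expanded by bilinearity with `D(Gᵢ, Gⱼ) = ∫_{2t}^∞ G_u(xᵢ - xⱼ) du`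
(`integral_prod_gaussian_gaussian_coulomb`) and `D(Gᵢ, ρ) = ∫ ρ V_t(xᵢ - ·)`
(`integral_prod_gaussian_mul_coulomb`). [cite: LiebSeiringer2009, Lemma 6.1 (6.4.3)] -/
theorem onsager_clouds_nonneg {N : ℕ} (X : Fin N → Space) {t : ℝ} (ht : 0 < t) {ρ : Space → ℝ}
    (hρm : Measurable ρ) (hρ : Integrable ρ)
    (hρρ : Integrable (fun z : Space × Space => ρ z.1 * ρ z.2 * (4 * π * ‖z.1 - z.2‖)⁻¹)
      (volume.prod volume)) :
    0 ≤ (∑ i, ∑ j, ∫ u in Ioi (2 * t), heatKernel u (X i - X j)) -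
        2 * (∑ i, ∫ y, ρ y * ∫ u in Ioi t, heatKernel u (X i - y)) +
        ∫ z : Space × Space, ρ z.1 * ρ z.2 * (4 * π * ‖z.1 - z.2‖)⁻¹ ∂(volume.prod volume) := by
  set g : Space → ℝ := fun x => ∑ i, heatKernel t (x - X i) with hg
  have hGm : ∀ b : Space, Measurable fun x : Space => heatKernel t (x - b) := fun b =>
    (continuous_heatKernel t).measurable.comp (measurable_id.sub measurable_const)
  have hgm : Measurable g := Finset.measurable_sum _ fun i _ => hGm (X i)
  have hgi : Integrable g :=
    integrable_finsetSum _ fun i _ =>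
      (integrable_heatKernel_holds (E := Space) ht).comp_sub_right (X i)
  -- cloud–cloud
  have hGG : ∀ i j, Integrable (fun z : Space × Space =>
      heatKernel t (z.1 - X i) * heatKernel t (z.2 - X j) * (4 * π * ‖z.1 - z.2‖)⁻¹)
        (volume.prod volume) ∧
      ∫ z : Space × Space, heatKernel t (z.1 - X i) * heatKernel t (z.2 - X j) *
          (4 * π * ‖z.1 - z.2‖)⁻¹ ∂(volume.prod volume) =
        ∫ u in Ioi (2 * t), heatKernel u (X i - X j) := by
    intro i j
    have h := integral_prod_gaussian_gaussian_coulomb ht ht (X i) (X j)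
    rw [← two_mul] at h
    exact h
  -- cloud–background
  have hGρ : ∀ i, Integrable (fun z : Space × Space =>
      heatKernel t (z.1 - X i) * ρ z.2 * (4 * π * ‖z.1 - z.2‖)⁻¹) (volume.prod volume) ∧
      ∫ z : Space × Space, heatKernel t (z.1 - X i) * ρ z.2 * (4 * π * ‖z.1 - z.2‖)⁻¹
          ∂(volume.prod volume) = ∫ y, ρ y * ∫ u in Ioi t, heatKernel u (X i - y) := by
    intro i
    obtain ⟨h1, h2⟩ := integral_prod_gaussian_mul_coulomb ht (X i) hρm hρ
    refine ⟨h1, ?_⟩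
    rw [h2]
    refine integral_congr_ae (Eventually.of_forall fun y => ?_)
    simp only
    congr 1
    refine integral_congr_ae (Eventually.of_forall fun u => ?_)
    simp only
    rw [← heatKernel_neg, neg_sub]
  -- the pieces of `D(g - ρ, g - ρ)`
  have hexp_gg : (fun z : Space × Space => g z.1 * g z.2 * (4 * π * ‖z.1 - z.2‖)⁻¹) =
      fun z => ∑ i, ∑ j, heatKernel t (z.1 - X i) * heatKernel t (z.2 - X j) *
        (4 * π * ‖z.1 - z.2‖)⁻¹ := by
    funext z
    simp only [hg]
    rw [Finset.sum_mul_sum, Finset.sum_mul]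
    refine Finset.sum_congr rfl fun i _ => ?_
    rw [Finset.sum_mul]
  have hexp_gρ : (fun z : Space × Space => g z.1 * ρ z.2 * (4 * π * ‖z.1 - z.2‖)⁻¹) =
      fun z => ∑ i, heatKernel t (z.1 - X i) * ρ z.2 * (4 * π * ‖z.1 - z.2‖)⁻¹ := by
    funext z
    simp only [hg]
    rw [Finset.sum_mul, Finset.sum_mul]
  have hgg_int : Integrable (fun z : Space × Space => g z.1 * g z.2 * (4 * π * ‖z.1 - z.2‖)⁻¹)
      (volume.prod volume) := by
    rw [hexp_gg]
    exact integrable_finsetSum _ fun i _ => integrable_finsetSum _ fun j _ => (hGG i j).1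
  have hgρ_int : Integrable (fun z : Space × Space => g z.1 * ρ z.2 * (4 * π * ‖z.1 - z.2‖)⁻¹)
      (volume.prod volume) := by
    rw [hexp_gρ]
    exact integrable_finsetSum _ fun i _ => (hGρ i).1
  have hgg_val : ∫ z : Space × Space, g z.1 * g z.2 * (4 * π * ‖z.1 - z.2‖)⁻¹ ∂(volume.prod volume) =
      ∑ i, ∑ j, ∫ u in Ioi (2 * t), heatKernel u (X i - X j) := by
    rw [hexp_gg, integral_finsetSum _ (fun i _ =>
      integrable_finsetSum _ fun j _ => (hGG i j).1)]
    refine Finset.sum_congr rfl fun i _ => ?_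
    rw [integral_finsetSum _ (fun j _ => (hGG i j).1)]
    exact Finset.sum_congr rfl fun j _ => (hGG i j).2
  have hgρ_val : ∫ z : Space × Space, g z.1 * ρ z.2 * (4 * π * ‖z.1 - z.2‖)⁻¹ ∂(volume.prod volume) =
      ∑ i, ∫ y, ρ y * ∫ u in Ioi t, heatKernel u (X i - y) := by
    rw [hexp_gρ, integral_finsetSum _ (fun i _ => (hGρ i).1)]
    exact Finset.sum_congr rfl fun i _ => (hGρ i).2
  obtain ⟨hρg_int, hρg_val⟩ := coulombForm_symm hgρ_int
  -- `f = g - ρ`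
  set f : Space → ℝ := fun x => g x - ρ x with hf
  have hfm : Measurable f := hgm.sub hρm
  have hfi : Integrable f := hgi.sub hρ
  have h12 : Integrable (fun z : Space × Space =>
      g z.1 * g z.2 * (4 * π * ‖z.1 - z.2‖)⁻¹ - g z.1 * ρ z.2 * (4 * π * ‖z.1 - z.2‖)⁻¹)
      (volume.prod volume) := hgg_int.sub hgρ_int
  have h123 : Integrable (fun z : Space × Space =>
      g z.1 * g z.2 * (4 * π * ‖z.1 - z.2‖)⁻¹ - g z.1 * ρ z.2 * (4 * π * ‖z.1 - z.2‖)⁻¹ -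
        ρ z.1 * g z.2 * (4 * π * ‖z.1 - z.2‖)⁻¹) (volume.prod volume) := h12.sub hρg_int
  have e1 : ∫ z : Space × Space, (g z.1 * g z.2 * (4 * π * ‖z.1 - z.2‖)⁻¹ -
      g z.1 * ρ z.2 * (4 * π * ‖z.1 - z.2‖)⁻¹) ∂(volume.prod volume) =
      (∫ z : Space × Space, g z.1 * g z.2 * (4 * π * ‖z.1 - z.2‖)⁻¹ ∂(volume.prod volume)) -
        ∫ z : Space × Space, g z.1 * ρ z.2 * (4 * π * ‖z.1 - z.2‖)⁻¹ ∂(volume.prod volume) :=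
    integral_sub hgg_int hgρ_int
  have e2 : ∫ z : Space × Space, (g z.1 * g z.2 * (4 * π * ‖z.1 - z.2‖)⁻¹ -
      g z.1 * ρ z.2 * (4 * π * ‖z.1 - z.2‖)⁻¹ - ρ z.1 * g z.2 * (4 * π * ‖z.1 - z.2‖)⁻¹)
        ∂(volume.prod volume) =
      (∫ z : Space × Space, (g z.1 * g z.2 * (4 * π * ‖z.1 - z.2‖)⁻¹ -
        g z.1 * ρ z.2 * (4 * π * ‖z.1 - z.2‖)⁻¹) ∂(volume.prod volume)) -
        ∫ z : Space × Space, ρ z.1 * g z.2 * (4 * π * ‖z.1 - z.2‖)⁻¹ ∂(volume.prod volume) :=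
    integral_sub h12 hρg_int
  have e3 : ∫ z : Space × Space, (g z.1 * g z.2 * (4 * π * ‖z.1 - z.2‖)⁻¹ -
      g z.1 * ρ z.2 * (4 * π * ‖z.1 - z.2‖)⁻¹ - ρ z.1 * g z.2 * (4 * π * ‖z.1 - z.2‖)⁻¹ +
        ρ z.1 * ρ z.2 * (4 * π * ‖z.1 - z.2‖)⁻¹) ∂(volume.prod volume) =
      (∫ z : Space × Space, (g z.1 * g z.2 * (4 * π * ‖z.1 - z.2‖)⁻¹ -
        g z.1 * ρ z.2 * (4 * π * ‖z.1 - z.2‖)⁻¹ - ρ z.1 * g z.2 * (4 * π * ‖z.1 - z.2‖)⁻¹)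
          ∂(volume.prod volume)) +
        ∫ z : Space × Space, ρ z.1 * ρ z.2 * (4 * π * ‖z.1 - z.2‖)⁻¹ ∂(volume.prod volume) :=
    integral_add h123 hρρ
  have e4 : ∫ z : Space × Space, f z.1 * f z.2 * (4 * π * ‖z.1 - z.2‖)⁻¹ ∂(volume.prod volume) =
      ∫ z : Space × Space, (g z.1 * g z.2 * (4 * π * ‖z.1 - z.2‖)⁻¹ -
        g z.1 * ρ z.2 * (4 * π * ‖z.1 - z.2‖)⁻¹ - ρ z.1 * g z.2 * (4 * π * ‖z.1 - z.2‖)⁻¹ +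
          ρ z.1 * ρ z.2 * (4 * π * ‖z.1 - z.2‖)⁻¹) ∂(volume.prod volume) := by
    refine integral_congr_ae (Eventually.of_forall fun z => ?_)
    simp only [hf]
    ring
  have hffi : Integrable (fun z : Space × Space => f z.1 * f z.2 * (4 * π * ‖z.1 - z.2‖)⁻¹)
      (volume.prod volume) := by
    refine (h123.add hρρ).congr (Eventually.of_forall fun z => ?_)
    simp only [hf, Pi.add_apply]
    ring
  have hpos := coulombEnergy_nonneg hfm hfi hffi
  rw [e4, e3, e2, e1, hρg_val, hgg_val, hgρ_val] at hpos
  linarith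

/-- **Onsager's lemma with Gaussian clouds** [Onsager1939; LiebSeiringer2009, Lemma 6.1 (6.4.1)]:
for DISTINCT points `x₁, …, x_N ∈ ℝ³`, `t > 0` and a real measurable background density
`ρ ∈ L¹(ℝ³)` of finite absolute Coulomb energy,
`∑ᵢ ∫ ρ(y) V_t(xᵢ - y) dy - ½ ∬ ρ(x)ρ(y)(4π|x - y|)⁻¹ - N/(8π√(2πt)) ≤ ∑_{i<j} (4π|xᵢ - xⱼ|)⁻¹`,
`V_t(z) = ∫_t^∞ G_u(z) du` the potential of the unit cloud `G_t`: from `onsager_clouds_nonneg`,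
the self-energies `∫_{2t}^∞ G_u(0) du = (4π√(2πt))⁻¹` and the domination
`∫_{2t}^∞ G_u(xᵢ - xⱼ) du ≤ (4π|xᵢ - xⱼ|)⁻¹` (`i ≠ j`). In Lieb–Seiringer's normalisation
`D = ½∬·/|x-y| = 2π · ∬·(4π|x-y|)⁻¹` this is (6.4.1) with `eᵢ = 1`, `μ_{xᵢ} = G_t(· - xᵢ)`
(Gaussian instead of compactly supported clouds; Newton's theorem replaced by subordination).
[cite: LiebSeiringer2009, Lemma 6.1 (6.4.1)] -/
theorem onsager_lemma {N : ℕ} {X : Fin N → Space} (hX : Function.Injective X) {t : ℝ}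
    (ht : 0 < t) {ρ : Space → ℝ} (hρm : Measurable ρ) (hρ : Integrable ρ)
    (hρρ : Integrable (fun z : Space × Space => ρ z.1 * ρ z.2 * (4 * π * ‖z.1 - z.2‖)⁻¹)
      (volume.prod volume)) :
    (∑ i, ∫ y, ρ y * ∫ u in Ioi t, heatKernel u (X i - y)) -
        1 / 2 * ∫ z : Space × Space, ρ z.1 * ρ z.2 * (4 * π * ‖z.1 - z.2‖)⁻¹ ∂(volume.prod volume) -
        N / (8 * π * Real.sqrt (2 * π * t)) ≤
      ∑ i, ∑ j with i < j, (4 * π * ‖X i - X j‖)⁻¹ := by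
  have h0 := onsager_clouds_nonneg X ht hρm hρ hρρ
  set a : Fin N → Fin N → ℝ := fun i j => ∫ u in Ioi (2 * t), heatKernel u (X i - X j) with ha
  have hsymm : ∀ i j, a i j = a j i := fun i j => by
    simp only [ha]
    refine integral_congr_ae (Eventually.of_forall fun u => ?_)
    simp only
    rw [← heatKernel_neg, neg_sub]
  have h2t : 0 < 2 * t := by positivity
  have hdiag : ∀ i, a i i = (4 * π * Real.sqrt (2 * π * t))⁻¹ := fun i => by
    simp only [ha, sub_self]
    rw [(integral_Ioi_heatKernel_zero h2t).2, show π * (2 * t) = 2 * π * t by ring]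
  have hoff : ∀ i j, i < j → a i j ≤ (4 * π * ‖X i - X j‖)⁻¹ := fun i j hij =>
    cloudPotential_le_coulomb h2t.le (sub_ne_zero.2 (hX.ne hij.ne))
  have hsplit := sum_sum_eq_diag_add_two_mul a hsymm
  have hdiag_sum : ∑ i, a i i = N * (4 * π * Real.sqrt (2 * π * t))⁻¹ := by
    rw [Finset.sum_congr rfl fun i _ => hdiag i, Finset.sum_const, Finset.card_univ,
      Fintype.card_fin, nsmul_eq_mul]
  have hoff_sum : ∑ i, ∑ j with i < j, a i j ≤ ∑ i, ∑ j with i < j, (4 * π * ‖X i - X j‖)⁻¹ :=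
    Finset.sum_le_sum fun i _ => Finset.sum_le_sum fun j hj => hoff i j (Finset.mem_filter.1 hj).2
  have hsq : 0 < Real.sqrt (2 * π * t) := Real.sqrt_pos.2 (by positivity)
  have hc : (N : ℝ) / (8 * π * Real.sqrt (2 * π * t)) =
      1 / 2 * (N * (4 * π * Real.sqrt (2 * π * t))⁻¹) := by
    field_simp
    ring
  rw [hc]
  rw [hsplit, hdiag_sum] at h0
  linarith [hoff_sum]

end Literature.MathematicalPhysics.QuantumManyBody.Coulomb
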